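import Summits.SmoothPoincare4.SmoothPoincare4.Theorems.SullivanDualWitnessChargeHelperLocalNormalForm
import Mathlib.Analysis.Calculus.InverseFunctionTheorem.Deriv
import Mathlib.Analysis.Complex.OpenMapping
import Mathlib.RingTheory.RootsOfUnity.Complex

/-!
# Values without exactly one simple preimage form an open set

Crux `WitnessCharge` (statement item `stmt-SmoothPoincare4-7824`), line `Sketch`,
stub `helper_properHolo_badIsOpen` (degree theory of proper holomorphic maps between planar open
sets, part 4).

Let `Z` be holomorphic on an open set `U ⊆ ℂ` with values in an open set `A`, nowhere locally
constant on `U`, and with upper semicontinuous fibres: every open set containing the fibre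
`U ∩ Z ⁻¹' {a₁}` of a value `a₁ ∈ A` contains the fibres of all values near `a₁`.  Call a value
`a ∈ A` *good* if it has exactly one preimage `ξ₀ ∈ U` and `deriv Z ξ₀ ≠ 0`.  We show that the set
`A \ G` of values of `A` that are not good is open.

Given `a₁ ∈ A \ G` we produce a neighbourhood of `a₁` containing no good value `c ≠ a₁`:
* if the fibre of `a₁` is empty, upper semicontinuity (with the empty open set) gives a
  neighbourhood of `a₁` all of whose values have empty fibres;
* if `a₁` has two distinct preimages `ξ₁ ≠ ξ₂`, the open mapping theorem
  (`AnalyticAt.eventually_constant_or_nhds_le_map_nhds`) applied on disjoint neighbourhoods of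
  `ξ₁` and `ξ₂` shows that every value close to `a₁` has a preimage near `ξ₁` and another one
  near `ξ₂`;
* if `a₁` has exactly one preimage `ξ₁`, then `deriv Z ξ₁ = 0` (as `a₁` is not good), so in the
  local normal form `Z = a₁ + φ ^ n` at `ξ₁` (`helper_localNormalForm`) the multiplicity `n` is at
  least `2`; rotating the coordinate `φ` by a primitive `n`-th root of unity `ζ ≠ 1` (and using
  the inverse function theorem for `φ`) turns any preimage `z` near `ξ₁` of a value `c ≠ a₁` into
  a second preimage `z' ≠ z`.

## Main results

* `helper_properHolo_badIsOpen_of_two`: a value with two distinct preimages is not good.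
* `helper_properHolo_badIsOpen_image_mem_nhds`: open mapping near a point of `U`.
* `helper_properHolo_badIsOpen_two_preimages`: values near a critical value `Z ξ₁`
  (`deriv Z ξ₁ = 0`) other than `Z ξ₁` itself have two distinct preimages.
* `helper_properHolo_badIsOpen`: the set of values that are not good is open.
-/

noncomputable section

set_option linter.dupNamespace false

open Set Filter Topology Metric

namespace Summit.SmoothPoincare4.SmoothPoincare4.Theorems.WitnessCharge.PencilIncompleteness

/-- **Two distinct preimages exclude a value from the good set.** If `c` has two distinct
preimages `z₁ ≠ z₂` under `Z` in `U`, then `c` does not have exactly one simple preimage. -/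
theorem helper_properHolo_badIsOpen_of_two {Z : ℂ → ℂ} {U : Set ℂ} {c z₁ z₂ : ℂ}
    (h₁ : z₁ ∈ U) (h₂ : z₂ ∈ U) (hz₁ : Z z₁ = c) (hz₂ : Z z₂ = c) (hne : z₁ ≠ z₂) :
    ¬ ∃ ξ₀ ∈ U, Z ξ₀ = c ∧ deriv Z ξ₀ ≠ 0 ∧ ∀ ξ ∈ U, Z ξ = c → ξ = ξ₀ := by
  rintro ⟨ξ₀, -, -, -, huniq⟩
  exact hne ((huniq z₁ h₁ hz₁).trans (huniq z₂ h₂ hz₂).symm)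

/-- **Open mapping near a point of `U`.** If `Z` is holomorphic on the open set `U` and nowhere
locally constant there, then for every `ξ₁ ∈ U` the image of every neighbourhood of `ξ₁` is a
neighbourhood of `Z ξ₁` (`AnalyticAt.eventually_constant_or_nhds_le_map_nhds`). -/
theorem helper_properHolo_badIsOpen_image_mem_nhds {Z : ℂ → ℂ} {U : Set ℂ} (hU : IsOpen U)
    (hZ : DifferentiableOn ℂ Z U) (hnlc : ∀ ξ ∈ U, ¬ (∀ᶠ z in 𝓝 ξ, Z z = Z ξ))
    {ξ₁ : ℂ} (hξ₁ : ξ₁ ∈ U) {W : Set ℂ} (hW : W ∈ 𝓝 ξ₁) : Z '' W ∈ 𝓝 (Z ξ₁) :=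
  ((hZ.analyticAt (hU.mem_nhds hξ₁)).eventually_constant_or_nhds_le_map_nhds.resolve_left
    (hnlc ξ₁ hξ₁)) (image_mem_map hW)

/-- **Two preimages near a critical point.** Let `Z` be holomorphic on the open set `U`, nowhere
locally constant there, and let `ξ₁ ∈ U` with `deriv Z ξ₁ = 0`.  Then every value `c ≠ Z ξ₁`
close enough to `Z ξ₁` has two distinct preimages under `Z` in `U`.

Proof: by `helper_localNormalForm`, `Z z = Z ξ₁ + (φ z) ^ n` near `ξ₁` with `φ` a local
holomorphic coordinate at `ξ₁` and `n ≠ 1` (because `deriv Z ξ₁ = 0`), so `n ≥ 2` and there is a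
primitive `n`-th root of unity `ζ ≠ 1`.  On an open neighbourhood `N ⊆ U` of `ξ₁` the normal form
holds, and by the inverse function theorem `φ '' N ⊇ ball 0 ρ` for some `ρ > 0`.  By the open
mapping theorem every `c` close to `Z ξ₁` is `Z z` for some `z ∈ N` with `‖φ z‖ < ρ`; if
`c ≠ Z ξ₁` then `φ z ≠ 0`, and `ζ * φ z ∈ ball 0 ρ` is `φ z'` for some `z' ∈ N`, whence
`Z z' = Z ξ₁ + (ζ * φ z) ^ n = c` and `z' ≠ z` (as `φ z' = ζ * φ z ≠ φ z`). -/
theorem helper_properHolo_badIsOpen_two_preimages {Z : ℂ → ℂ} {U : Set ℂ} (hU : IsOpen U)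
    (hZ : DifferentiableOn ℂ Z U) (hnlc : ∀ ξ ∈ U, ¬ (∀ᶠ z in 𝓝 ξ, Z z = Z ξ))
    {ξ₁ : ℂ} (hξ₁ : ξ₁ ∈ U) (hder : deriv Z ξ₁ = 0) :
    ∀ᶠ c in 𝓝 (Z ξ₁), c ≠ Z ξ₁ → ∃ z ∈ U, ∃ z' ∈ U, Z z = c ∧ Z z' = c ∧ z ≠ z' := by
  have han : AnalyticAt ℂ Z ξ₁ := hZ.analyticAt (hU.mem_nhds hξ₁)
  obtain ⟨n, φ, hn, hφ, hφ0, hφ', hnf, hiff⟩ := helper_localNormalForm Z ξ₁ han (hnlc ξ₁ hξ₁)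
  have h1n : 1 < n := by
    have hn1 : n ≠ 1 := fun h1 => hiff.mp h1 hder
    omega
  -- a primitive `n`-th root of unity `ζ ≠ 1`
  obtain ⟨ζ, hζ⟩ : ∃ ζ : ℂ, IsPrimitiveRoot ζ n := ⟨_, Complex.isPrimitiveRoot_exp n hn.ne'⟩
  have hζ1 : ζ ≠ 1 := hζ.ne_one h1n
  have hζn : ζ ^ n = 1 := hζ.pow_eq_one
  have hζnorm : ‖ζ‖ = 1 := hζ.norm'_eq_one hn.ne'
  -- an open neighbourhood `N ⊆ U` of `ξ₁` on which the normal form holds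
  have hall : ∀ᶠ z in 𝓝 ξ₁, Z z = Z ξ₁ + φ z ^ n ∧ z ∈ U :=
    hnf.and (Filter.eventually_mem_set.mpr (hU.mem_nhds hξ₁))
  obtain ⟨N, hN, hNopen, hξ₁N⟩ := _root_.eventually_nhds_iff.mp hall
  -- inverse function theorem: `φ '' N` is a neighbourhood of `0 = φ ξ₁`; choose a ball inside it
  have himage : φ '' N ∈ 𝓝 (0 : ℂ) := by
    have h := image_mem_map (m := φ) (hNopen.mem_nhds hξ₁N)
    rw [hφ.hasStrictDerivAt.map_nhds_eq hφ', hφ0] at h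
    exact h
  obtain ⟨ρ, hρ, hball⟩ := Metric.mem_nhds_iff.mp himage
  -- open mapping theorem on the neighbourhood `N ∩ φ ⁻¹' ball 0 ρ` of `ξ₁`
  have hV : N ∩ φ ⁻¹' ball 0 ρ ∈ 𝓝 ξ₁ := by
    refine inter_mem (hNopen.mem_nhds hξ₁N) (hφ.continuousAt.preimage_mem_nhds ?_)
    rw [hφ0]
    exact ball_mem_nhds 0 hρ
  filter_upwards [helper_properHolo_badIsOpen_image_mem_nhds hU hZ hnlc hξ₁ hV] with c hc hca₁
  obtain ⟨z, ⟨hzN, hzρ⟩, rfl⟩ := hc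
  have hZz : Z z = Z ξ₁ + φ z ^ n := (hN z hzN).1
  have hφz : φ z ≠ 0 := by
    intro h0
    apply hca₁
    rw [hZz, h0, zero_pow hn.ne', add_zero]
  -- the rotated coordinate value `ζ * φ z` is attained at some `z' ∈ N`
  have hmem : ζ * φ z ∈ ball (0 : ℂ) ρ := by
    rw [mem_ball_zero_iff, norm_mul, hζnorm, one_mul]
    exact mem_ball_zero_iff.mp hzρ
  obtain ⟨z', hz'N, hz'φ⟩ := hball hmem
  refine ⟨z, (hN z hzN).2, z', (hN z' hz'N).2, rfl, ?_, ?_⟩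
  · rw [(hN z' hz'N).1, hz'φ, mul_pow, hζn, one_mul, hZz]
  · intro hzz'
    rw [← hzz'] at hz'φ
    have h0 : (ζ - 1) * φ z = 0 := by rw [sub_mul, one_mul, ← hz'φ, sub_self]
    exact hφz ((mul_eq_zero.mp h0).resolve_left (sub_ne_zero.mpr hζ1))

/-- **The set of values WITHOUT exactly one simple preimage is open.** Let `Z` be holomorphic on
the open set `U` with values in the open set `A`, with upper semicontinuous fibres (every open set
containing the fibre of `a₁ ∈ A` contains the fibres of all values near `a₁`) and nowhere locally
constant on `U`.  Then the complement in `A` of the set of *good* values — those `a ∈ A` with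
exactly one preimage `ξ₀ ∈ U`, at which moreover `deriv Z ξ₀ ≠ 0` — is open.

Proof: fix a value `a₁ ∈ A` that is not good; it suffices to find a neighbourhood of `a₁` in which
no `c ≠ a₁` is good.  If the fibre of `a₁` is empty, upper semicontinuity applied to the open set
`∅` gives a neighbourhood whose values all have empty fibres, hence are not good.  If `a₁` has two
preimages `ξ₁ ≠ ξ₂`, separate them by disjoint open sets `u₁ ∋ ξ₁`, `u₂ ∋ ξ₂`; by the open mapping
theorem (`helper_properHolo_badIsOpen_image_mem_nhds`) the set `Z '' (u₁ ∩ U) ∩ Z '' (u₂ ∩ U)`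
is a neighbourhood of `a₁`, and each of its values has a preimage in `u₁ ∩ U` and one in `u₂ ∩ U`,
hence two distinct preimages.  If `ξ₁` is the only preimage of `a₁`, then `deriv Z ξ₁ = 0` since
`a₁` is not good, and `helper_properHolo_badIsOpen_two_preimages` gives a neighbourhood of `a₁`
in which every `c ≠ a₁` has two distinct preimages. -/
theorem helper_properHolo_badIsOpen :
    ∀ (Z : ℂ → ℂ) (U A : Set ℂ), IsOpen U → IsOpen A → DifferentiableOn ℂ Z U → MapsTo Z U A →
      (∀ a₁ ∈ A, ∀ V : Set ℂ, IsOpen V → U ∩ Z ⁻¹' {a₁} ⊆ V →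
        ∃ W ∈ 𝓝 a₁, W ⊆ A ∧ ∀ a ∈ W, U ∩ Z ⁻¹' {a} ⊆ V) →
      (∀ ξ ∈ U, ¬ (∀ᶠ z in 𝓝 ξ, Z z = Z ξ)) →
      IsOpen (A \ {a ∈ A | ∃ ξ₀ ∈ U, Z ξ₀ = a ∧ deriv Z ξ₀ ≠ 0 ∧ ∀ ξ ∈ U, Z ξ = a → ξ = ξ₀}) := by
  intro Z U A hU hA hZ _hZA husc hnlc
  rw [isOpen_iff_mem_nhds]
  rintro a₁ ⟨ha₁A, ha₁G⟩
  -- it suffices to find a neighbourhood of `a₁` containing no good value other than possibly `a₁`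
  suffices key : ∃ N ∈ 𝓝 a₁, ∀ c ∈ N, c ≠ a₁ →
      ¬ ∃ ξ₀ ∈ U, Z ξ₀ = c ∧ deriv Z ξ₀ ≠ 0 ∧ ∀ ξ ∈ U, Z ξ = c → ξ = ξ₀ by
    obtain ⟨N, hN, hNbad⟩ := key
    filter_upwards [hA.mem_nhds ha₁A, hN] with c hcA hcN
    refine ⟨hcA, ?_⟩
    rintro ⟨-, hgood⟩
    rcases eq_or_ne c a₁ with rfl | hc
    · exact ha₁G ⟨hcA, hgood⟩
    · exact hNbad c hcN hc hgood
  rcases (U ∩ Z ⁻¹' {a₁}).eq_empty_or_nonempty with hempty | ⟨ξ₁, hξ₁U, hξ₁⟩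
  · -- (α) the fibre of `a₁` is empty, hence so are all nearby fibres
    obtain ⟨W, hW, -, hWfib⟩ := husc a₁ ha₁A ∅ isOpen_empty hempty.subset
    refine ⟨W, hW, fun c hcW _ => ?_⟩
    rintro ⟨ξ₀, hξ₀U, hξ₀c, -, -⟩
    exact Set.notMem_empty ξ₀ (hWfib c hcW ⟨hξ₀U, hξ₀c⟩)
  · have hZξ₁ : Z ξ₁ = a₁ := hξ₁
    by_cases htwo : ∃ ξ₂ ∈ U, Z ξ₂ = a₁ ∧ ξ₂ ≠ ξ₁
    · -- (β) two distinct preimages `ξ₁ ≠ ξ₂` of `a₁`: nearby values have preimages near both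
      obtain ⟨ξ₂, hξ₂U, hZξ₂, hne⟩ := htwo
      obtain ⟨u₁, u₂, hu₁, hu₂, hξ₁u₁, hξ₂u₂, hdisj⟩ := t2_separation hne.symm
      have h₁ := helper_properHolo_badIsOpen_image_mem_nhds hU hZ hnlc hξ₁U
        ((hu₁.inter hU).mem_nhds ⟨hξ₁u₁, hξ₁U⟩)
      have h₂ := helper_properHolo_badIsOpen_image_mem_nhds hU hZ hnlc hξ₂U
        ((hu₂.inter hU).mem_nhds ⟨hξ₂u₂, hξ₂U⟩)
      rw [hZξ₁] at h₁
      rw [hZξ₂] at h₂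
      refine ⟨_, inter_mem h₁ h₂, fun c hc _ => ?_⟩
      obtain ⟨⟨z₁, hz₁, hz₁c⟩, ⟨z₂, hz₂, hz₂c⟩⟩ := hc
      refine helper_properHolo_badIsOpen_of_two hz₁.2 hz₂.2 hz₁c hz₂c ?_
      intro h
      exact Set.disjoint_left.mp hdisj hz₁.1 (by rw [h]; exact hz₂.1)
    · -- (γ) `ξ₁` is the only preimage of `a₁`; as `a₁` is not good, `deriv Z ξ₁ = 0`
      push Not at htwo
      have hder : deriv Z ξ₁ = 0 := by
        by_contra h
        exact ha₁G ⟨ha₁A, ξ₁, hξ₁U, hZξ₁, h, htwo⟩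
      have h₂ := helper_properHolo_badIsOpen_two_preimages hU hZ hnlc hξ₁U hder
      rw [hZξ₁] at h₂
      refine ⟨_, h₂, fun c hc hca₁ => ?_⟩
      obtain ⟨z, hz, z', hz', hzc, hz'c, hne⟩ := hc hca₁
      exact helper_properHolo_badIsOpen_of_two hz hz' hzc hz'c hne

end Summit.SmoothPoincare4.SmoothPoincare4.Theorems.WitnessCharge.PencilIncompleteness
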